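import Literature.RepresentationTheory.MoeglinVignerasWaldspurger1987.RankOneThetaLiftLinesDisjointOfBlockComplement
import Literature.NumberTheory.GelbartRogawski1991.LocalLineModelTransport
import HarnessLib

/-!
# The SEPARATION of two transported rank-one theta lifts at a non-split place FROM THE BLOCK-0 TRACE RELATION — the (P′) socket of the LD2 line's
# R₂ road, in the currency of [Liu2021, §D.1]'s line-model transports (frame PRESENTED AS A BLOCK SUM `T₁ ⊕ T₂`)

Topic `NumberTheory/Automorphic/Liu2021`; namespace `Literature.NumberTheory.Automorphic.Liu2021.Def411WeilCarriers` (that of ★ `LemD1Item4AtV2NonsplitEpsOfSeparation`,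
whose `hsep` hypothesis this file PRODUCES).  KERNEL ONLY: theorems, no definition, no named fact, no `sorry`, no instance, no notation.  Cell hodgecm-mathlib,
half A line LD2 (socket `stub_S1b_facts`, #74R; R₂ road, LD2-plan (g2) DEALS #3a plate (1′)), LD2-p01 (g2); `--supports stmt-HodgeConjecture-24832`.

THE POINT.  ★ `sameClass_and_chi_eq_of_areIsomorphicRep_localType₂_nonsplit_of_separation` (LD1-p01 (g2), p850033) pays the `(ε, χ)`-clauses of
[Liu2021, Lem. D.1 (4)] at a non-split `v` from the hypothesis `hsep` = «the rank-one theta lifts through the two transported sections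
`lineTransportSection … a_j …`, `lineTransportSection … a_i …` are SEPARATED at `v`» (shape of ★ `rankOne_theta_lines_disjoint`).  At an isotropic `v` that is ★
`rankOne_theta_lines_disjoint_of_isotropic`; at an ANISOTROPIC `v` it is paid here from the (P′) organ of the line LD2: **`hsep_of_blockZero_trace_eq_neg`** — if the
frame is the block sum `T₁ ⊕ T₂` (`T₁` a `1 × 1` line, `T₂` any `n₂ × n₂`) and the two FIRST-BLOCK oscillator representations `ω^{T₁} ∘ restrictLeft` of the
transported sections have OPPOSITE finite-level traces near every `z ∉ {1, −1}` of `U(J₁)(F_v)` (hypothesis `hrel`, VERBATIM the `hrel` of ★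
`rankOne_finrank_weightSpace_add_eq_one_of_trace_eq_neg`, measure-free), then `hsep` holds (for ANY pair-model sections `s′_j, s′_i` and ANY centre characters
`χ_j, χ_i`; the class antecedent of `hsep` is not even used).  Proof: ★ `rankOne_theta_lines_disjoint_of_blockZero_trace_eq_neg` (p850184 = ★ thm A p850122 ∘
★ `blockComplement_of_finrank_weightSpace_add_eq_one` ∘ ★ `rankOne_theta_lines_disjoint_of_blockComplement`) at the sections `lineTransportSection … a_t …`
(sections over `ι_{a_t⁻¹δ}` by ★ `proj_lineTransportSection`, smooth by ★ `isSmooth_lineTransportSection`).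
§2 (edition 2) `hsep_of_blockZero_trace_eq_neg_of_eq` — the same for a frame `T_V` GIVEN EQUAL to `T₁ ⊕ T₂` (`hT : finSum 1 n₂ T₁ T₂ = T_V`; the consumer's
sections typed over `T_V`, block-frame copies linked by `HEq`, the socket on the copies; `subst`-transport, cf. ★ `congrW`).
§3–§4 (edition 3) `hsep_of_blockZero_complement`, `hsep_of_blockZero_complement_of_eq` — the same two statements through the COMPLEMENTARITY door: hypothesis =
the `hdich` of ★ `blockComplement_of_finrank_weightSpace_add_eq_one` («`dim ω_{a′,0}[ξ] + dim ω_{a,0}[ξ] = 1` for every open-kernel `ξ`» — the printed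
rank-one dichotomy [HarrisKudlaSweet1996, Cor. 4.4] ∕ [SunZhu2014, Thm. 1.10] on the two block-0 sections; the organ `LineThetaTypesComplementary₁` of the line
LD2 asserts exactly this on the rank-one CM package sections), no trace relation, no thm A.

CONSUMERS.  LD2-p02 (g2)'s organ `BlockZeroTraceOpposite₂` closes over R₂'s CM binders with body = this `hrel` at the CM package sections (frame `realDiagonal L dV`
presented as `(dV₀) ⊕ (dV₁)` by a matrix identity of the shape of ★ `gram_diagonal_units_TW_eq_finSum`, `subst`-transport as in ★
`rankOne_theta_anisotropicPlane_dichotomy_of_eq`); LD1-p01 (g2)'s `Theorems/F0LD1SameLabelRigidityOfSeparation` consumes `hsep`.  HONEST SCOPE: nothing of [Liu2021] is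
asserted; HC_CM is proved only modulo the 7 printed citations (2 remaining: hLiu418 = stmt-HodgeConjecture-24832, h413 = stmt-HodgeConjecture-24833) until rung 0
closes; count-neutral.

## References
* [Liu2021] Y. Liu, Camb. J. Math. 9 (2021) = arXiv:2102.11518 — App. D §D.1 Steps 1–3 (l. 5213–5224), Lemma D.1 (4) (p. 126, l. 5235).
* [MoeglinVignerasWaldspurger1987] C. Mœglin, M.-F. Vignéras, J.-L. Waldspurger, LNM 1291 (1987), Chap. 2 II.1 (A), Rem. (6); Chap. 3 §IV.4.
* [HarrisKudlaSweet1996] M. Harris, S. Kudla, W. J. Sweet, J. AMS 9 (1996), Cor. 4.4 p. 962, Thm. 6.1.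
* [SunZhu2014] B. Sun, C.-B. Zhu, J. AMS 28 (2015), Thm. 1.10.
-/

set_option autoImplicit false

noncomputable section

open scoped Matrix Kronecker
open NumberField IsDedekindDomain
open Literature.NumberTheory.Automorphic Literature.NumberTheory.Automorphic.UnitaryGroup
open Literature.RepresentationTheory
open Literature.RepresentationTheory.HeisenbergGroup (MpPsi)
open Literature.RepresentationTheory.TwistedCoinv
open Literature.NumberTheory.GelbartRogawski1991 Literature.NumberTheory.GelbartRogawski1991.UnitaryDualPair
open Literature.NumberTheory.GelbartRogawski1991.UnitaryDualPair.WeilCoinv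
open Literature.NumberTheory.GelbartRogawski1991.UnitaryDualPair.LocalSplitting
open Literature.NumberTheory.GelbartRogawski1991.UnitaryDualPair.LocalSplitting.BlockSum
open Literature.RepresentationTheory.MoeglinVignerasWaldspurger1987

namespace Literature.NumberTheory.Automorphic.Liu2021.Def411WeilCarriers

variable (F E : Type) [Field F] [NumberField F] [Field E] [NumberField E] [Algebra F E]
  [Algebra.IsQuadraticExtension F E] (c : E ≃ₐ[F] E) {n₂ : ℕ}
  {δ : E} (hcδ : c δ = -δ) (hδ : δ ≠ 0) {d : F} (hd : δ * δ = algebraMap F E d)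
  {T₁ : Matrix (Fin 1) (Fin 1) F} {T₂ : Matrix (Fin n₂) (Fin n₂) F} (hT₁ : T₁.IsSymm) (hT₂ : T₂.IsSymm)
  (hT₁d : IsUnit T₁.det) (hT₂d : IsUnit T₂.det)
  {J₁ : Matrix (Fin 1) (Fin 1) E} (hJ₁ : J₁ = T₁.map (algebraMap F E))
  {J₂ : Matrix (Fin n₂) (Fin n₂) E} (hJ₂ : J₂ = T₂.map (algebraMap F E))
  (JV : Matrix (Fin (1 + n₂)) (Fin (1 + n₂)) E) (hJV : JV = (UnitaryGroup.finSum 1 n₂ T₁ T₂).map (algebraMap F E))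
  (aⱼ aᵢ : Fˣ) (v : HeightOneSpectrum (𝓞 F))
  (sⱼ' : localPi E c (1 + n₂) (Matrix.reindex (Equiv.prodUnique (Fin (1 + n₂)) (Fin 1)) (Equiv.prodUnique (Fin (1 + n₂)) (Fin 1)) (JV ⊗ₖ JW F E aⱼ)) v →*
      LocalMp F (1 + n₂) (gram F (Equiv.prodUnique (Fin (1 + n₂)) (Fin 1)) (UnitaryGroup.finSum 1 n₂ T₁ T₂) (TW F aⱼ)) v)
  (hsⱼ' : ∀ g, MpPsi.proj _ (sⱼ' g) = iota F E c (1 + n₂) hcδ hδ hd (gram F (Equiv.prodUnique (Fin (1 + n₂)) (Fin 1)) (UnitaryGroup.finSum 1 n₂ T₁ T₂) (TW F aⱼ))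
      (isSymm_gram F (Equiv.prodUnique (Fin (1 + n₂)) (Fin 1)) (UnitaryGroup.isSymm_finSum hT₁ hT₂) (isSymm_TW F aⱼ))
      (reindex_kronecker_eq_gram_map F E (Equiv.prodUnique (Fin (1 + n₂)) (Fin 1)) hJV (JW_eq F E aⱼ)) v g)
  (sᵢ' : localPi E c (1 + n₂) (Matrix.reindex (Equiv.prodUnique (Fin (1 + n₂)) (Fin 1)) (Equiv.prodUnique (Fin (1 + n₂)) (Fin 1)) (JV ⊗ₖ JW F E aᵢ)) v →*
      LocalMp F (1 + n₂) (gram F (Equiv.prodUnique (Fin (1 + n₂)) (Fin 1)) (UnitaryGroup.finSum 1 n₂ T₁ T₂) (TW F aᵢ)) v)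
  (hsᵢ' : ∀ g, MpPsi.proj _ (sᵢ' g) = iota F E c (1 + n₂) hcδ hδ hd (gram F (Equiv.prodUnique (Fin (1 + n₂)) (Fin 1)) (UnitaryGroup.finSum 1 n₂ T₁ T₂) (TW F aᵢ))
      (isSymm_gram F (Equiv.prodUnique (Fin (1 + n₂)) (Fin 1)) (UnitaryGroup.isSymm_finSum hT₁ hT₂) (isSymm_TW F aᵢ))
      (reindex_kronecker_eq_gram_map F E (Equiv.prodUnique (Fin (1 + n₂)) (Fin 1)) hJV (JW_eq F E aᵢ)) v g)

-- the block-currency composite at two line-model transports: about 3× the default budget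
set_option maxHeartbeats 800000 in
include hT₁d hJ₂ in
/-- **SEPARATION AT `v` FROM THE BLOCK-0 TRACE RELATION** (the (P′) socket ⇒ `hsep`).  Frame `T₁ ⊕ T₂` (`JV = (T₁ ⊕ T₂) ⊗ 1`), two lines `a_j, a_i` with
pair-model sections `s′_j, s′_i` transported to `U(J_V)(F_v)` by ★ `lineTransportSection` (sections over `ι_{a_t⁻¹ δ}`), `E_v` a field: if the two FIRST-BLOCK
oscillator representations `ω^{T₁} ∘ restrictLeft (lineTransportSection … a_i …)` and `… a_j …` have OPPOSITE finite-level traces near every `z ∉ {1, −1}`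
of `U(J₁)(F_v)` (`hrel` — VERBATIM the hypothesis of ★ `rankOne_finrank_weightSpace_add_eq_one_of_trace_eq_neg` at these two rank-one sections; the organ
(P′)), then the two transported theta lifts are SEPARATED at `v`: for any centre characters `χ_j, χ_i` of `U((a_j))(F_v)`, `Θ_{s_j}(χ_j) ≠ 0` and
`Θ_{s_j}(χ_j) ≅ Θ_{s_i}(χ_i)` are incompatible — the `hsep` hypothesis of ★ `sameClass_and_chi_eq_of_areIsomorphicRep_nonsplit_of_separation_of_modelTransport`
(its class antecedent is not used).  Proof: ★ `rankOne_theta_lines_disjoint_of_blockZero_trace_eq_neg`.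
[cite: MoeglinVignerasWaldspurger1987, Chap. 3 §IV.4; Chap. 2 II.1 (A), Rem. (6)] [cite: HarrisKudlaSweet1996, Cor. 4.4 p. 962]
[cite: SunZhu2014, Thm. 1.10] [cite: Liu2021, App. D Lemma D.1 (4) (p. 126, l. 5235)] -/
theorem hsep_of_blockZero_trace_eq_neg (hE : IsField (LocalRing E v))
    (hsmⱼ : Representation.IsSmooth
      ((MpPsi.toRep (localSchrodinger F (1 + n₂) (gram F (Equiv.prodUnique (Fin (1 + n₂)) (Fin 1)) (UnitaryGroup.finSum 1 n₂ T₁ T₂) (TW F aⱼ)) v)).comp sⱼ'))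
    (hsmᵢ : Representation.IsSmooth
      ((MpPsi.toRep (localSchrodinger F (1 + n₂) (gram F (Equiv.prodUnique (Fin (1 + n₂)) (Fin 1)) (UnitaryGroup.finSum 1 n₂ T₁ T₂) (TW F aᵢ)) v)).comp sᵢ'))
    (hrel : ∀ z : localPi E c 1 J₁ v, z ≠ 1 → z ≠ localUnitScalar E c J₁ v (-1) (negOne_mul_conjLocal_negOne E c v) →
      ∃ K₀ : Subgroup (localPi E c 1 J₁ v), IsOpen (K₀ : Set (localPi E c 1 J₁ v)) ∧
        ∀ u : localPi E c 1 J₁ v, z⁻¹ * u ∈ K₀ →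
          ∀ L : Subgroup (localPi E c 1 J₁ v), IsOpen (L : Set (localPi E c 1 J₁ v)) → L ≤ K₀ →
            LinearMap.trace ℂ (Representation.fixedPoints ((MpPsi.toRep (localSchrodinger F 1 T₁ v)).comp
                (restrictLeft F E c v 1 n₂ hJ₁ hJV (conj_lineDelta hcδ aᵢ) (lineDelta_ne_zero hδ aᵢ) (lineDelta_mul_self hd aᵢ) hT₁ hT₂ hT₂d (lineTransportSection F E c (1 + n₂) hcδ hδ hd (UnitaryGroup.finSum 1 n₂ T₁ T₂) (UnitaryGroup.isSymm_finSum hT₁ hT₂) JV hJV aᵢ v sᵢ' hsᵢ') (proj_lineTransportSection F E c (1 + n₂) hcδ hδ hd (UnitaryGroup.finSum 1 n₂ T₁ T₂) (UnitaryGroup.isSymm_finSum hT₁ hT₂) JV hJV aᵢ v sᵢ' hsᵢ'))) L)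
                (((((MpPsi.toRep (localSchrodinger F 1 T₁ v)).comp
                (restrictLeft F E c v 1 n₂ hJ₁ hJV (conj_lineDelta hcδ aᵢ) (lineDelta_ne_zero hδ aᵢ) (lineDelta_mul_self hd aᵢ) hT₁ hT₂ hT₂d (lineTransportSection F E c (1 + n₂) hcδ hδ hd (UnitaryGroup.finSum 1 n₂ T₁ T₂) (UnitaryGroup.isSymm_finSum hT₁ hT₂) JV hJV aᵢ v sᵢ' hsᵢ') (proj_lineTransportSection F E c (1 + n₂) hcδ hδ hd (UnitaryGroup.finSum 1 n₂ T₁ T₂) (UnitaryGroup.isSymm_finSum hT₁ hT₂) JV hJV aᵢ v sᵢ' hsᵢ')))) u).restrict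
                  (apply_mem_fixedPoints_of_comm ((MpPsi.toRep (localSchrodinger F 1 T₁ v)).comp
                (restrictLeft F E c v 1 n₂ hJ₁ hJV (conj_lineDelta hcδ aᵢ) (lineDelta_ne_zero hδ aᵢ) (lineDelta_mul_self hd aᵢ) hT₁ hT₂ hT₂d (lineTransportSection F E c (1 + n₂) hcδ hδ hd (UnitaryGroup.finSum 1 n₂ T₁ T₂) (UnitaryGroup.isSymm_finSum hT₁ hT₂) JV hJV aᵢ v sᵢ' hsᵢ') (proj_lineTransportSection F E c (1 + n₂) hcδ hδ hd (UnitaryGroup.finSum 1 n₂ T₁ T₂) (UnitaryGroup.isSymm_finSum hT₁ hT₂) JV hJV aᵢ v sᵢ' hsᵢ')))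
                    (localPi_one_mul_comm E c J₁ v) L u)) =
              -(LinearMap.trace ℂ (Representation.fixedPoints ((MpPsi.toRep (localSchrodinger F 1 T₁ v)).comp
                (restrictLeft F E c v 1 n₂ hJ₁ hJV (conj_lineDelta hcδ aⱼ) (lineDelta_ne_zero hδ aⱼ) (lineDelta_mul_self hd aⱼ) hT₁ hT₂ hT₂d (lineTransportSection F E c (1 + n₂) hcδ hδ hd (UnitaryGroup.finSum 1 n₂ T₁ T₂) (UnitaryGroup.isSymm_finSum hT₁ hT₂) JV hJV aⱼ v sⱼ' hsⱼ') (proj_lineTransportSection F E c (1 + n₂) hcδ hδ hd (UnitaryGroup.finSum 1 n₂ T₁ T₂) (UnitaryGroup.isSymm_finSum hT₁ hT₂) JV hJV aⱼ v sⱼ' hsⱼ'))) L)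
                  (((((MpPsi.toRep (localSchrodinger F 1 T₁ v)).comp
                (restrictLeft F E c v 1 n₂ hJ₁ hJV (conj_lineDelta hcδ aⱼ) (lineDelta_ne_zero hδ aⱼ) (lineDelta_mul_self hd aⱼ) hT₁ hT₂ hT₂d (lineTransportSection F E c (1 + n₂) hcδ hδ hd (UnitaryGroup.finSum 1 n₂ T₁ T₂) (UnitaryGroup.isSymm_finSum hT₁ hT₂) JV hJV aⱼ v sⱼ' hsⱼ') (proj_lineTransportSection F E c (1 + n₂) hcδ hδ hd (UnitaryGroup.finSum 1 n₂ T₁ T₂) (UnitaryGroup.isSymm_finSum hT₁ hT₂) JV hJV aⱼ v sⱼ' hsⱼ')))) u).restrict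
                    (apply_mem_fixedPoints_of_comm ((MpPsi.toRep (localSchrodinger F 1 T₁ v)).comp
                (restrictLeft F E c v 1 n₂ hJ₁ hJV (conj_lineDelta hcδ aⱼ) (lineDelta_ne_zero hδ aⱼ) (lineDelta_mul_self hd aⱼ) hT₁ hT₂ hT₂d (lineTransportSection F E c (1 + n₂) hcδ hδ hd (UnitaryGroup.finSum 1 n₂ T₁ T₂) (UnitaryGroup.isSymm_finSum hT₁ hT₂) JV hJV aⱼ v sⱼ' hsⱼ') (proj_lineTransportSection F E c (1 + n₂) hcδ hδ hd (UnitaryGroup.finSum 1 n₂ T₁ T₂) (UnitaryGroup.isSymm_finSum hT₁ hT₂) JV hJV aⱼ v sⱼ' hsⱼ')))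
                      (localPi_one_mul_comm E c J₁ v) L u))))
    (χⱼ χᵢ : localPi E c 1 (JW F E aⱼ) v →* ℂˣ) :
    (¬ ∃ x : (LocalRing E v)ˣ, LemD1OfPlace.eps E v (lineDelta_ne_zero hδ aᵢ) =
        x * Units.map (conjLocal E c v : LocalRing E v →* LocalRing E v) x * LemD1OfPlace.eps E v (lineDelta_ne_zero hδ aⱼ)) →
      Nontrivial (TwistedCoinv.Coinv
        ((show Representation ℂ (localPi E c 1 (JW F E aⱼ) v) (SchwartzBruhat (Fin (1 + n₂) → v.adicCompletion F)) from
          ((MpPsi.toRep (localSchrodinger F (1 + n₂) (UnitaryGroup.finSum 1 n₂ T₁ T₂) v)).comp (lineTransportSection F E c (1 + n₂) hcδ hδ hd (UnitaryGroup.finSum 1 n₂ T₁ T₂) (UnitaryGroup.isSymm_finSum hT₁ hT₂) JV hJV aⱼ v sⱼ' hsⱼ')).comp (localCenter E c (1 + n₂) JV (JW F E aⱼ) (JW_apply_ne_zero F E aⱼ) v))) χⱼ) →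
      AreIsomorphicRep
        (TwistedCoinv.rep
          (ρW := show Representation ℂ (localPi E c 1 (JW F E aⱼ) v) (SchwartzBruhat (Fin (1 + n₂) → v.adicCompletion F)) from
            ((MpPsi.toRep (localSchrodinger F (1 + n₂) (UnitaryGroup.finSum 1 n₂ T₁ T₂) v)).comp (lineTransportSection F E c (1 + n₂) hcδ hδ hd (UnitaryGroup.finSum 1 n₂ T₁ T₂) (UnitaryGroup.isSymm_finSum hT₁ hT₂) JV hJV aⱼ v sⱼ' hsⱼ')).comp (localCenter E c (1 + n₂) JV (JW F E aⱼ) (JW_apply_ne_zero F E aⱼ) v))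
          χⱼ ((MpPsi.toRep (localSchrodinger F (1 + n₂) (UnitaryGroup.finSum 1 n₂ T₁ T₂) v)).comp (lineTransportSection F E c (1 + n₂) hcδ hδ hd (UnitaryGroup.finSum 1 n₂ T₁ T₂) (UnitaryGroup.isSymm_finSum hT₁ hT₂) JV hJV aⱼ v sⱼ' hsⱼ'))
          (fun g z => (show Commute g ((localCenter E c (1 + n₂) JV (JW F E aⱼ) (JW_apply_ne_zero F E aⱼ) v) z) from
            localCenter_comm E c (1 + n₂) JV (JW F E aⱼ) (JW_apply_ne_zero F E aⱼ) v z g).map ((MpPsi.toRep (localSchrodinger F (1 + n₂) (UnitaryGroup.finSum 1 n₂ T₁ T₂) v)).comp (lineTransportSection F E c (1 + n₂) hcδ hδ hd (UnitaryGroup.finSum 1 n₂ T₁ T₂) (UnitaryGroup.isSymm_finSum hT₁ hT₂) JV hJV aⱼ v sⱼ' hsⱼ'))))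
        (TwistedCoinv.rep
          (ρW := show Representation ℂ (localPi E c 1 (JW F E aⱼ) v) (SchwartzBruhat (Fin (1 + n₂) → v.adicCompletion F)) from
            ((MpPsi.toRep (localSchrodinger F (1 + n₂) (UnitaryGroup.finSum 1 n₂ T₁ T₂) v)).comp (lineTransportSection F E c (1 + n₂) hcδ hδ hd (UnitaryGroup.finSum 1 n₂ T₁ T₂) (UnitaryGroup.isSymm_finSum hT₁ hT₂) JV hJV aᵢ v sᵢ' hsᵢ')).comp (localCenter E c (1 + n₂) JV (JW F E aⱼ) (JW_apply_ne_zero F E aⱼ) v))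
          χᵢ ((MpPsi.toRep (localSchrodinger F (1 + n₂) (UnitaryGroup.finSum 1 n₂ T₁ T₂) v)).comp (lineTransportSection F E c (1 + n₂) hcδ hδ hd (UnitaryGroup.finSum 1 n₂ T₁ T₂) (UnitaryGroup.isSymm_finSum hT₁ hT₂) JV hJV aᵢ v sᵢ' hsᵢ'))
          (fun g z => (show Commute g ((localCenter E c (1 + n₂) JV (JW F E aⱼ) (JW_apply_ne_zero F E aⱼ) v) z) from
            localCenter_comm E c (1 + n₂) JV (JW F E aⱼ) (JW_apply_ne_zero F E aⱼ) v z g).map ((MpPsi.toRep (localSchrodinger F (1 + n₂) (UnitaryGroup.finSum 1 n₂ T₁ T₂) v)).comp (lineTransportSection F E c (1 + n₂) hcδ hδ hd (UnitaryGroup.finSum 1 n₂ T₁ T₂) (UnitaryGroup.isSymm_finSum hT₁ hT₂) JV hJV aᵢ v sᵢ' hsᵢ')))) →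
      False :=
  fun _ hnt hiso =>
    rankOne_theta_lines_disjoint_of_blockZero_trace_eq_neg F E c (conj_lineDelta hcδ aⱼ) (lineDelta_ne_zero hδ aⱼ) (lineDelta_mul_self hd aⱼ)
      (conj_lineDelta hcδ aᵢ) (lineDelta_ne_zero hδ aᵢ) (lineDelta_mul_self hd aᵢ) v n₂ hT₁ hT₂ hT₁d hT₂d hJ₁ hJ₂ hJV
      (lineTransportSection F E c (1 + n₂) hcδ hδ hd (UnitaryGroup.finSum 1 n₂ T₁ T₂) (UnitaryGroup.isSymm_finSum hT₁ hT₂) JV hJV aⱼ v sⱼ' hsⱼ')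
      (proj_lineTransportSection F E c (1 + n₂) hcδ hδ hd (UnitaryGroup.finSum 1 n₂ T₁ T₂) (UnitaryGroup.isSymm_finSum hT₁ hT₂) JV hJV aⱼ v sⱼ' hsⱼ')
      (lineTransportSection F E c (1 + n₂) hcδ hδ hd (UnitaryGroup.finSum 1 n₂ T₁ T₂) (UnitaryGroup.isSymm_finSum hT₁ hT₂) JV hJV aᵢ v sᵢ' hsᵢ')
      (proj_lineTransportSection F E c (1 + n₂) hcδ hδ hd (UnitaryGroup.finSum 1 n₂ T₁ T₂) (UnitaryGroup.isSymm_finSum hT₁ hT₂) JV hJV aᵢ v sᵢ' hsᵢ')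
      (JW_apply_ne_zero F E aⱼ) hE
      (isSmooth_lineTransportSection F E c (1 + n₂) hcδ hδ hd (UnitaryGroup.finSum 1 n₂ T₁ T₂) (UnitaryGroup.isSymm_finSum hT₁ hT₂) JV hJV aⱼ v sⱼ' hsⱼ' hsmⱼ)
      (isSmooth_lineTransportSection F E c (1 + n₂) hcδ hδ hd (UnitaryGroup.finSum 1 n₂ T₁ T₂) (UnitaryGroup.isSymm_finSum hT₁ hT₂) JV hJV aᵢ v sᵢ' hsᵢ' hsmᵢ)
      hrel χⱼ χᵢ hnt hiso

/-! ## §2 (edition 2) The same with the frame as a VARIABLE (`T₁ ⊕ T₂ = T_V` as a hypothesis; `subst`-transport) -/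

section OfEq

variable {TV' : Matrix (Fin (1 + n₂)) (Fin (1 + n₂)) F} (hT : UnitaryGroup.finSum 1 n₂ T₁ T₂ = TV') (hV' : TV'.IsSymm)
  (hJV' : JV = TV'.map (algebraMap F E)) (hJVf : JV = (UnitaryGroup.finSum 1 n₂ T₁ T₂).map (algebraMap F E))
  -- the consumer's pair-model sections, typed over ITS frame `T_V`
  (sⱼ'' : localPi E c (1 + n₂) (Matrix.reindex (Equiv.prodUnique (Fin (1 + n₂)) (Fin 1)) (Equiv.prodUnique (Fin (1 + n₂)) (Fin 1)) (JV ⊗ₖ JW F E aⱼ)) v →*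
      LocalMp F (1 + n₂) (gram F (Equiv.prodUnique (Fin (1 + n₂)) (Fin 1)) TV' (TW F aⱼ)) v)
  (hsⱼ'' : ∀ g, MpPsi.proj _ (sⱼ'' g) = iota F E c (1 + n₂) hcδ hδ hd (gram F (Equiv.prodUnique (Fin (1 + n₂)) (Fin 1)) TV' (TW F aⱼ))
      (isSymm_gram F (Equiv.prodUnique (Fin (1 + n₂)) (Fin 1)) hV' (isSymm_TW F aⱼ))
      (reindex_kronecker_eq_gram_map F E (Equiv.prodUnique (Fin (1 + n₂)) (Fin 1)) hJV' (JW_eq F E aⱼ)) v g)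
  (sᵢ'' : localPi E c (1 + n₂) (Matrix.reindex (Equiv.prodUnique (Fin (1 + n₂)) (Fin 1)) (Equiv.prodUnique (Fin (1 + n₂)) (Fin 1)) (JV ⊗ₖ JW F E aᵢ)) v →*
      LocalMp F (1 + n₂) (gram F (Equiv.prodUnique (Fin (1 + n₂)) (Fin 1)) TV' (TW F aᵢ)) v)
  (hsᵢ'' : ∀ g, MpPsi.proj _ (sᵢ'' g) = iota F E c (1 + n₂) hcδ hδ hd (gram F (Equiv.prodUnique (Fin (1 + n₂)) (Fin 1)) TV' (TW F aᵢ))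
      (isSymm_gram F (Equiv.prodUnique (Fin (1 + n₂)) (Fin 1)) hV' (isSymm_TW F aᵢ))
      (reindex_kronecker_eq_gram_map F E (Equiv.prodUnique (Fin (1 + n₂)) (Fin 1)) hJV' (JW_eq F E aᵢ)) v g)
  -- their block-frame copies (`HEq`-linked; after `subst hT` they ARE the sections)
  (rⱼ' : localPi E c (1 + n₂) (Matrix.reindex (Equiv.prodUnique (Fin (1 + n₂)) (Fin 1)) (Equiv.prodUnique (Fin (1 + n₂)) (Fin 1)) (JV ⊗ₖ JW F E aⱼ)) v →*
      LocalMp F (1 + n₂) (gram F (Equiv.prodUnique (Fin (1 + n₂)) (Fin 1)) (UnitaryGroup.finSum 1 n₂ T₁ T₂) (TW F aⱼ)) v)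
  (hrⱼ' : ∀ g, MpPsi.proj _ (rⱼ' g) = iota F E c (1 + n₂) hcδ hδ hd (gram F (Equiv.prodUnique (Fin (1 + n₂)) (Fin 1)) (UnitaryGroup.finSum 1 n₂ T₁ T₂) (TW F aⱼ))
      (isSymm_gram F (Equiv.prodUnique (Fin (1 + n₂)) (Fin 1)) (UnitaryGroup.isSymm_finSum hT₁ hT₂) (isSymm_TW F aⱼ))
      (reindex_kronecker_eq_gram_map F E (Equiv.prodUnique (Fin (1 + n₂)) (Fin 1)) hJVf (JW_eq F E aⱼ)) v g)
  (rᵢ' : localPi E c (1 + n₂) (Matrix.reindex (Equiv.prodUnique (Fin (1 + n₂)) (Fin 1)) (Equiv.prodUnique (Fin (1 + n₂)) (Fin 1)) (JV ⊗ₖ JW F E aᵢ)) v →*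
      LocalMp F (1 + n₂) (gram F (Equiv.prodUnique (Fin (1 + n₂)) (Fin 1)) (UnitaryGroup.finSum 1 n₂ T₁ T₂) (TW F aᵢ)) v)
  (hrᵢ' : ∀ g, MpPsi.proj _ (rᵢ' g) = iota F E c (1 + n₂) hcδ hδ hd (gram F (Equiv.prodUnique (Fin (1 + n₂)) (Fin 1)) (UnitaryGroup.finSum 1 n₂ T₁ T₂) (TW F aᵢ))
      (isSymm_gram F (Equiv.prodUnique (Fin (1 + n₂)) (Fin 1)) (UnitaryGroup.isSymm_finSum hT₁ hT₂) (isSymm_TW F aᵢ))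
      (reindex_kronecker_eq_gram_map F E (Equiv.prodUnique (Fin (1 + n₂)) (Fin 1)) hJVf (JW_eq F E aᵢ)) v g)

-- the composite after two `subst`s: about 3× the default budget
set_option maxHeartbeats 800000 in
include hT₁d hJ₂ hT hrⱼ' hrᵢ' in
/-- **SEPARATION AT `v` FROM THE BLOCK-0 TRACE RELATION, FRAME AS A VARIABLE** (edition 2): the statement of `hsep_of_blockZero_trace_eq_neg` for a consumer whose
frame `T_V` is typed by another Gram term PROPOSITIONALLY equal to `T₁ ⊕ T₂` (`hT : UnitaryGroup.finSum 1 n₂ T₁ T₂ = T_V` — e.g. the real diagonal frame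
`realDiagonal L dV` of the rank-2 CM θ-package, a matrix identity of the shape of ★ `gram_diagonal_units_TW_eq_finSum`): the consumer's pair-model sections
`s″_t` (typed over `T_V`) come with block-frame copies `r′_t` linked by `HEq` (e.g. `r′_t := hT ▸ s″_t`), the (P′) socket `hrel` is stated on the copies, and
the conclusion is the `hsep` of ★ `sameClass_and_chi_eq_of_areIsomorphicRep_nonsplit_of_separation_of_modelTransport` over `T_V` itself.  Proof: `subst hT`,
`eq_of_heq`, then §1 (the tree's transport idiom, cf. ★ `congrW`, ★ `rankOne_theta_anisotropicPlane_dichotomy_of_eq`).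
[cite: MoeglinVignerasWaldspurger1987, Chap. 3 §IV.4; Chap. 2 II.1 (A), Rem. (6)] [cite: HarrisKudlaSweet1996, Cor. 4.4 p. 962] [cite: SunZhu2014, Thm. 1.10]
[cite: Liu2021, App. D Lemma D.1 (4) (p. 126, l. 5235)] -/
theorem hsep_of_blockZero_trace_eq_neg_of_eq (hE : IsField (LocalRing E v))
    (hheqⱼ : HEq rⱼ' sⱼ'') (hheqᵢ : HEq rᵢ' sᵢ'')
    (hsmⱼ : Representation.IsSmooth
      ((MpPsi.toRep (localSchrodinger F (1 + n₂) (gram F (Equiv.prodUnique (Fin (1 + n₂)) (Fin 1)) TV' (TW F aⱼ)) v)).comp sⱼ''))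
    (hsmᵢ : Representation.IsSmooth
      ((MpPsi.toRep (localSchrodinger F (1 + n₂) (gram F (Equiv.prodUnique (Fin (1 + n₂)) (Fin 1)) TV' (TW F aᵢ)) v)).comp sᵢ''))
    (hrel : ∀ z : localPi E c 1 J₁ v, z ≠ 1 → z ≠ localUnitScalar E c J₁ v (-1) (negOne_mul_conjLocal_negOne E c v) →
      ∃ K₀ : Subgroup (localPi E c 1 J₁ v), IsOpen (K₀ : Set (localPi E c 1 J₁ v)) ∧
        ∀ u : localPi E c 1 J₁ v, z⁻¹ * u ∈ K₀ →
          ∀ L : Subgroup (localPi E c 1 J₁ v), IsOpen (L : Set (localPi E c 1 J₁ v)) → L ≤ K₀ →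
            LinearMap.trace ℂ (Representation.fixedPoints ((MpPsi.toRep (localSchrodinger F 1 T₁ v)).comp
                (restrictLeft F E c v 1 n₂ hJ₁ hJVf (conj_lineDelta hcδ aᵢ) (lineDelta_ne_zero hδ aᵢ) (lineDelta_mul_self hd aᵢ) hT₁ hT₂ hT₂d (lineTransportSection F E c (1 + n₂) hcδ hδ hd (UnitaryGroup.finSum 1 n₂ T₁ T₂) (UnitaryGroup.isSymm_finSum hT₁ hT₂) JV hJVf aᵢ v rᵢ' hrᵢ') (proj_lineTransportSection F E c (1 + n₂) hcδ hδ hd (UnitaryGroup.finSum 1 n₂ T₁ T₂) (UnitaryGroup.isSymm_finSum hT₁ hT₂) JV hJVf aᵢ v rᵢ' hrᵢ'))) L)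
                (((((MpPsi.toRep (localSchrodinger F 1 T₁ v)).comp
                (restrictLeft F E c v 1 n₂ hJ₁ hJVf (conj_lineDelta hcδ aᵢ) (lineDelta_ne_zero hδ aᵢ) (lineDelta_mul_self hd aᵢ) hT₁ hT₂ hT₂d (lineTransportSection F E c (1 + n₂) hcδ hδ hd (UnitaryGroup.finSum 1 n₂ T₁ T₂) (UnitaryGroup.isSymm_finSum hT₁ hT₂) JV hJVf aᵢ v rᵢ' hrᵢ') (proj_lineTransportSection F E c (1 + n₂) hcδ hδ hd (UnitaryGroup.finSum 1 n₂ T₁ T₂) (UnitaryGroup.isSymm_finSum hT₁ hT₂) JV hJVf aᵢ v rᵢ' hrᵢ')))) u).restrict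
                  (apply_mem_fixedPoints_of_comm ((MpPsi.toRep (localSchrodinger F 1 T₁ v)).comp
                (restrictLeft F E c v 1 n₂ hJ₁ hJVf (conj_lineDelta hcδ aᵢ) (lineDelta_ne_zero hδ aᵢ) (lineDelta_mul_self hd aᵢ) hT₁ hT₂ hT₂d (lineTransportSection F E c (1 + n₂) hcδ hδ hd (UnitaryGroup.finSum 1 n₂ T₁ T₂) (UnitaryGroup.isSymm_finSum hT₁ hT₂) JV hJVf aᵢ v rᵢ' hrᵢ') (proj_lineTransportSection F E c (1 + n₂) hcδ hδ hd (UnitaryGroup.finSum 1 n₂ T₁ T₂) (UnitaryGroup.isSymm_finSum hT₁ hT₂) JV hJVf aᵢ v rᵢ' hrᵢ')))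
                    (localPi_one_mul_comm E c J₁ v) L u)) =
              -(LinearMap.trace ℂ (Representation.fixedPoints ((MpPsi.toRep (localSchrodinger F 1 T₁ v)).comp
                (restrictLeft F E c v 1 n₂ hJ₁ hJVf (conj_lineDelta hcδ aⱼ) (lineDelta_ne_zero hδ aⱼ) (lineDelta_mul_self hd aⱼ) hT₁ hT₂ hT₂d (lineTransportSection F E c (1 + n₂) hcδ hδ hd (UnitaryGroup.finSum 1 n₂ T₁ T₂) (UnitaryGroup.isSymm_finSum hT₁ hT₂) JV hJVf aⱼ v rⱼ' hrⱼ') (proj_lineTransportSection F E c (1 + n₂) hcδ hδ hd (UnitaryGroup.finSum 1 n₂ T₁ T₂) (UnitaryGroup.isSymm_finSum hT₁ hT₂) JV hJVf aⱼ v rⱼ' hrⱼ'))) L)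
                  (((((MpPsi.toRep (localSchrodinger F 1 T₁ v)).comp
                (restrictLeft F E c v 1 n₂ hJ₁ hJVf (conj_lineDelta hcδ aⱼ) (lineDelta_ne_zero hδ aⱼ) (lineDelta_mul_self hd aⱼ) hT₁ hT₂ hT₂d (lineTransportSection F E c (1 + n₂) hcδ hδ hd (UnitaryGroup.finSum 1 n₂ T₁ T₂) (UnitaryGroup.isSymm_finSum hT₁ hT₂) JV hJVf aⱼ v rⱼ' hrⱼ') (proj_lineTransportSection F E c (1 + n₂) hcδ hδ hd (UnitaryGroup.finSum 1 n₂ T₁ T₂) (UnitaryGroup.isSymm_finSum hT₁ hT₂) JV hJVf aⱼ v rⱼ' hrⱼ')))) u).restrict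
                    (apply_mem_fixedPoints_of_comm ((MpPsi.toRep (localSchrodinger F 1 T₁ v)).comp
                (restrictLeft F E c v 1 n₂ hJ₁ hJVf (conj_lineDelta hcδ aⱼ) (lineDelta_ne_zero hδ aⱼ) (lineDelta_mul_self hd aⱼ) hT₁ hT₂ hT₂d (lineTransportSection F E c (1 + n₂) hcδ hδ hd (UnitaryGroup.finSum 1 n₂ T₁ T₂) (UnitaryGroup.isSymm_finSum hT₁ hT₂) JV hJVf aⱼ v rⱼ' hrⱼ') (proj_lineTransportSection F E c (1 + n₂) hcδ hδ hd (UnitaryGroup.finSum 1 n₂ T₁ T₂) (UnitaryGroup.isSymm_finSum hT₁ hT₂) JV hJVf aⱼ v rⱼ' hrⱼ')))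
                      (localPi_one_mul_comm E c J₁ v) L u))))
    (χⱼ χᵢ : localPi E c 1 (JW F E aⱼ) v →* ℂˣ) :
    (¬ ∃ x : (LocalRing E v)ˣ, LemD1OfPlace.eps E v (lineDelta_ne_zero hδ aᵢ) =
        x * Units.map (conjLocal E c v : LocalRing E v →* LocalRing E v) x * LemD1OfPlace.eps E v (lineDelta_ne_zero hδ aⱼ)) →
      Nontrivial (TwistedCoinv.Coinv
        ((show Representation ℂ (localPi E c 1 (JW F E aⱼ) v) (SchwartzBruhat (Fin (1 + n₂) → v.adicCompletion F)) from
          ((MpPsi.toRep (localSchrodinger F (1 + n₂) TV' v)).comp (lineTransportSection F E c (1 + n₂) hcδ hδ hd TV' hV' JV hJV' aⱼ v sⱼ'' hsⱼ'')).comp (localCenter E c (1 + n₂) JV (JW F E aⱼ) (JW_apply_ne_zero F E aⱼ) v))) χⱼ) →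
      AreIsomorphicRep
        (TwistedCoinv.rep
          (ρW := show Representation ℂ (localPi E c 1 (JW F E aⱼ) v) (SchwartzBruhat (Fin (1 + n₂) → v.adicCompletion F)) from
            ((MpPsi.toRep (localSchrodinger F (1 + n₂) TV' v)).comp (lineTransportSection F E c (1 + n₂) hcδ hδ hd TV' hV' JV hJV' aⱼ v sⱼ'' hsⱼ'')).comp (localCenter E c (1 + n₂) JV (JW F E aⱼ) (JW_apply_ne_zero F E aⱼ) v))
          χⱼ ((MpPsi.toRep (localSchrodinger F (1 + n₂) TV' v)).comp (lineTransportSection F E c (1 + n₂) hcδ hδ hd TV' hV' JV hJV' aⱼ v sⱼ'' hsⱼ''))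
          (fun g z => (show Commute g ((localCenter E c (1 + n₂) JV (JW F E aⱼ) (JW_apply_ne_zero F E aⱼ) v) z) from
            localCenter_comm E c (1 + n₂) JV (JW F E aⱼ) (JW_apply_ne_zero F E aⱼ) v z g).map ((MpPsi.toRep (localSchrodinger F (1 + n₂) TV' v)).comp (lineTransportSection F E c (1 + n₂) hcδ hδ hd TV' hV' JV hJV' aⱼ v sⱼ'' hsⱼ''))))
        (TwistedCoinv.rep
          (ρW := show Representation ℂ (localPi E c 1 (JW F E aⱼ) v) (SchwartzBruhat (Fin (1 + n₂) → v.adicCompletion F)) from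
            ((MpPsi.toRep (localSchrodinger F (1 + n₂) TV' v)).comp (lineTransportSection F E c (1 + n₂) hcδ hδ hd TV' hV' JV hJV' aᵢ v sᵢ'' hsᵢ'')).comp (localCenter E c (1 + n₂) JV (JW F E aⱼ) (JW_apply_ne_zero F E aⱼ) v))
          χᵢ ((MpPsi.toRep (localSchrodinger F (1 + n₂) TV' v)).comp (lineTransportSection F E c (1 + n₂) hcδ hδ hd TV' hV' JV hJV' aᵢ v sᵢ'' hsᵢ''))
          (fun g z => (show Commute g ((localCenter E c (1 + n₂) JV (JW F E aⱼ) (JW_apply_ne_zero F E aⱼ) v) z) from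
            localCenter_comm E c (1 + n₂) JV (JW F E aⱼ) (JW_apply_ne_zero F E aⱼ) v z g).map ((MpPsi.toRep (localSchrodinger F (1 + n₂) TV' v)).comp (lineTransportSection F E c (1 + n₂) hcδ hδ hd TV' hV' JV hJV' aᵢ v sᵢ'' hsᵢ'')))) →
      False := by
  subst hT
  obtain rfl := eq_of_heq hheqⱼ
  obtain rfl := eq_of_heq hheqᵢ
  exact hsep_of_blockZero_trace_eq_neg F E c hcδ hδ hd hT₁ hT₂ hT₁d hT₂d hJ₁ hJ₂ JV hJVf aⱼ aᵢ v rⱼ' hrⱼ' rᵢ' hrᵢ' hE hsmⱼ hsmᵢ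
    hrel χⱼ χᵢ

end OfEq

/-! ## §3 (edition 3) The COMPLEMENTARITY door: `hsep` from `dim ω_{a′,0}[ξ] + dim ω_{a,0}[ξ] = 1` (no trace relation, no thm A) -/

-- two block-currency theorems composed at two line-model transports: about 3× the default budget
set_option maxHeartbeats 800000 in
include hT₁d hJ₂ in
/-- **SEPARATION AT `v` FROM BLOCK-0 COMPLEMENTARITY** (the organ in its printed, rank-one-dichotomy form): frame `T₁ ⊕ T₂`, lines `a_j, a_i`, pair-model
sections transported by ★ `lineTransportSection`, `E_v` a field; IF for every open-kernel character `ξ` of `U(J₁)(F_v)` EXACTLY ONE of the two first-block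
oscillator representations `ω^{T₁} ∘ restrictLeft (lineTransportSection … a_j …)`, `… a_i …` has a non-zero `ξ`-weight space (`hdich`, the `hdich` of ★
`blockComplement_of_finrank_weightSpace_add_eq_one` VERBATIM at these sections = [HarrisKudlaSweet1996, Cor. 4.4] ∕ [SunZhu2014, Thm. 1.10] for `U(1)`, the
`θ = 1` conclusion of ★ `rankOne_theta_dichotomy`), THEN the `hsep` of ★ `sameClass_and_chi_eq_of_areIsomorphicRep_nonsplit_of_separation_of_modelTransport`
holds (any centre characters; class antecedent unused).  Proof: ★ p850040 §2 ∘ ★ p850028 §1 (the trace door §1–§2 above enters it through ★ thm A).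
[cite: HarrisKudlaSweet1996, Cor. 4.4 p. 962, Thm. 6.1] [cite: SunZhu2014, Thm. 1.10] [cite: MoeglinVignerasWaldspurger1987, Chap. 3 §IV.4; Chap. 2 II.1 (A), Rem. (6)]
[cite: Liu2021, App. D Lemma D.1 (4) (p. 126, l. 5235)] -/
theorem hsep_of_blockZero_complement (hE : IsField (LocalRing E v))
    (hsmⱼ : Representation.IsSmooth
      ((MpPsi.toRep (localSchrodinger F (1 + n₂) (gram F (Equiv.prodUnique (Fin (1 + n₂)) (Fin 1)) (UnitaryGroup.finSum 1 n₂ T₁ T₂) (TW F aⱼ)) v)).comp sⱼ'))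
    (hsmᵢ : Representation.IsSmooth
      ((MpPsi.toRep (localSchrodinger F (1 + n₂) (gram F (Equiv.prodUnique (Fin (1 + n₂)) (Fin 1)) (UnitaryGroup.finSum 1 n₂ T₁ T₂) (TW F aᵢ)) v)).comp sᵢ'))
    (hdich : ∀ ξ : localPi E c 1 J₁ v →* ℂˣ, IsOpen (ξ.ker : Set (localPi E c 1 J₁ v)) →
      Module.finrank ℂ (weightSpace ((MpPsi.toRep (localSchrodinger F 1 T₁ v)).comp
                (restrictLeft F E c v 1 n₂ hJ₁ hJV (conj_lineDelta hcδ aⱼ) (lineDelta_ne_zero hδ aⱼ) (lineDelta_mul_self hd aⱼ) hT₁ hT₂ hT₂d (lineTransportSection F E c (1 + n₂) hcδ hδ hd (UnitaryGroup.finSum 1 n₂ T₁ T₂) (UnitaryGroup.isSymm_finSum hT₁ hT₂) JV hJV aⱼ v sⱼ' hsⱼ') (proj_lineTransportSection F E c (1 + n₂) hcδ hδ hd (UnitaryGroup.finSum 1 n₂ T₁ T₂) (UnitaryGroup.isSymm_finSum hT₁ hT₂) JV hJV aⱼ v sⱼ' hsⱼ'))) id (fun k => ((ξ k : ℂˣ)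 : ℂ))) +
        Module.finrank ℂ (weightSpace ((MpPsi.toRep (localSchrodinger F 1 T₁ v)).comp
                (restrictLeft F E c v 1 n₂ hJ₁ hJV (conj_lineDelta hcδ aᵢ) (lineDelta_ne_zero hδ aᵢ) (lineDelta_mul_self hd aᵢ) hT₁ hT₂ hT₂d (lineTransportSection F E c (1 + n₂) hcδ hδ hd (UnitaryGroup.finSum 1 n₂ T₁ T₂) (UnitaryGroup.isSymm_finSum hT₁ hT₂) JV hJV aᵢ v sᵢ' hsᵢ') (proj_lineTransportSection F E c (1 + n₂) hcδ hδ hd (UnitaryGroup.finSum 1 n₂ T₁ T₂) (UnitaryGroup.isSymm_finSum hT₁ hT₂) JV hJV aᵢ v sᵢ' hsᵢ'))) id (fun k => ((ξ k : ℂˣ) : ℂ))) = 1)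
    (χⱼ χᵢ : localPi E c 1 (JW F E aⱼ) v →* ℂˣ) :
    (¬ ∃ x : (LocalRing E v)ˣ, LemD1OfPlace.eps E v (lineDelta_ne_zero hδ aᵢ) =
        x * Units.map (conjLocal E c v : LocalRing E v →* LocalRing E v) x * LemD1OfPlace.eps E v (lineDelta_ne_zero hδ aⱼ)) →
      Nontrivial (TwistedCoinv.Coinv
        ((show Representation ℂ (localPi E c 1 (JW F E aⱼ) v) (SchwartzBruhat (Fin (1 + n₂) → v.adicCompletion F)) from
          ((MpPsi.toRep (localSchrodinger F (1 + n₂) (UnitaryGroup.finSum 1 n₂ T₁ T₂) v)).comp (lineTransportSection F E c (1 + n₂) hcδ hδ hd (UnitaryGroup.finSum 1 n₂ T₁ T₂) (UnitaryGroup.isSymm_finSum hT₁ hT₂) JV hJV aⱼ v sⱼ' hsⱼ')).comp (localCenter E c (1 + n₂) JV (JW F E aⱼ) (JW_apply_ne_zero F E aⱼ) v))) χⱼ) →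
      AreIsomorphicRep
        (TwistedCoinv.rep
          (ρW := show Representation ℂ (localPi E c 1 (JW F E aⱼ) v) (SchwartzBruhat (Fin (1 + n₂) → v.adicCompletion F)) from
            ((MpPsi.toRep (localSchrodinger F (1 + n₂) (UnitaryGroup.finSum 1 n₂ T₁ T₂) v)).comp (lineTransportSection F E c (1 + n₂) hcδ hδ hd (UnitaryGroup.finSum 1 n₂ T₁ T₂) (UnitaryGroup.isSymm_finSum hT₁ hT₂) JV hJV aⱼ v sⱼ' hsⱼ')).comp (localCenter E c (1 + n₂) JV (JW F E aⱼ) (JW_apply_ne_zero F E aⱼ) v))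
          χⱼ ((MpPsi.toRep (localSchrodinger F (1 + n₂) (UnitaryGroup.finSum 1 n₂ T₁ T₂) v)).comp (lineTransportSection F E c (1 + n₂) hcδ hδ hd (UnitaryGroup.finSum 1 n₂ T₁ T₂) (UnitaryGroup.isSymm_finSum hT₁ hT₂) JV hJV aⱼ v sⱼ' hsⱼ'))
          (fun g z => (show Commute g ((localCenter E c (1 + n₂) JV (JW F E aⱼ) (JW_apply_ne_zero F E aⱼ) v) z) from
            localCenter_comm E c (1 + n₂) JV (JW F E aⱼ) (JW_apply_ne_zero F E aⱼ) v z g).map ((MpPsi.toRep (localSchrodinger F (1 + n₂) (UnitaryGroup.finSum 1 n₂ T₁ T₂) v)).comp (lineTransportSection F E c (1 + n₂) hcδ hδ hd (UnitaryGroup.finSum 1 n₂ T₁ T₂) (UnitaryGroup.isSymm_finSum hT₁ hT₂) JV hJV aⱼ v sⱼ' hsⱼ'))))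
        (TwistedCoinv.rep
          (ρW := show Representation ℂ (localPi E c 1 (JW F E aⱼ) v) (SchwartzBruhat (Fin (1 + n₂) → v.adicCompletion F)) from
            ((MpPsi.toRep (localSchrodinger F (1 + n₂) (UnitaryGroup.finSum 1 n₂ T₁ T₂) v)).comp (lineTransportSection F E c (1 + n₂) hcδ hδ hd (UnitaryGroup.finSum 1 n₂ T₁ T₂) (UnitaryGroup.isSymm_finSum hT₁ hT₂) JV hJV aᵢ v sᵢ' hsᵢ')).comp (localCenter E c (1 + n₂) JV (JW F E aⱼ) (JW_apply_ne_zero F E aⱼ) v))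
          χᵢ ((MpPsi.toRep (localSchrodinger F (1 + n₂) (UnitaryGroup.finSum 1 n₂ T₁ T₂) v)).comp (lineTransportSection F E c (1 + n₂) hcδ hδ hd (UnitaryGroup.finSum 1 n₂ T₁ T₂) (UnitaryGroup.isSymm_finSum hT₁ hT₂) JV hJV aᵢ v sᵢ' hsᵢ'))
          (fun g z => (show Commute g ((localCenter E c (1 + n₂) JV (JW F E aⱼ) (JW_apply_ne_zero F E aⱼ) v) z) from
            localCenter_comm E c (1 + n₂) JV (JW F E aⱼ) (JW_apply_ne_zero F E aⱼ) v z g).map ((MpPsi.toRep (localSchrodinger F (1 + n₂) (UnitaryGroup.finSum 1 n₂ T₁ T₂) v)).comp (lineTransportSection F E c (1 + n₂) hcδ hδ hd (UnitaryGroup.finSum 1 n₂ T₁ T₂) (UnitaryGroup.isSymm_finSum hT₁ hT₂) JV hJV aᵢ v sᵢ' hsᵢ')))) →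
      False :=
  fun _ hnt hiso =>
    rankOne_theta_lines_disjoint_of_blockComplement F E c (conj_lineDelta hcδ aⱼ) (lineDelta_ne_zero hδ aⱼ) (lineDelta_mul_self hd aⱼ)
      (conj_lineDelta hcδ aᵢ) (lineDelta_ne_zero hδ aᵢ) (lineDelta_mul_self hd aᵢ) v n₂ hT₁ hT₂ hT₁d hT₂d hJ₁ hJ₂ hJV
      (lineTransportSection F E c (1 + n₂) hcδ hδ hd (UnitaryGroup.finSum 1 n₂ T₁ T₂) (UnitaryGroup.isSymm_finSum hT₁ hT₂) JV hJV aⱼ v sⱼ' hsⱼ')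
      (proj_lineTransportSection F E c (1 + n₂) hcδ hδ hd (UnitaryGroup.finSum 1 n₂ T₁ T₂) (UnitaryGroup.isSymm_finSum hT₁ hT₂) JV hJV aⱼ v sⱼ' hsⱼ')
      (lineTransportSection F E c (1 + n₂) hcδ hδ hd (UnitaryGroup.finSum 1 n₂ T₁ T₂) (UnitaryGroup.isSymm_finSum hT₁ hT₂) JV hJV aᵢ v sᵢ' hsᵢ')
      (proj_lineTransportSection F E c (1 + n₂) hcδ hδ hd (UnitaryGroup.finSum 1 n₂ T₁ T₂) (UnitaryGroup.isSymm_finSum hT₁ hT₂) JV hJV aᵢ v sᵢ' hsᵢ')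
      (JW_apply_ne_zero F E aⱼ) hE
      (isSmooth_lineTransportSection F E c (1 + n₂) hcδ hδ hd (UnitaryGroup.finSum 1 n₂ T₁ T₂) (UnitaryGroup.isSymm_finSum hT₁ hT₂) JV hJV aⱼ v sⱼ' hsⱼ' hsmⱼ) χⱼ χᵢ
      (blockComplement_of_finrank_weightSpace_add_eq_one F E c (conj_lineDelta hcδ aⱼ) (lineDelta_ne_zero hδ aⱼ) (lineDelta_mul_self hd aⱼ)
        (conj_lineDelta hcδ aᵢ) (lineDelta_ne_zero hδ aᵢ) (lineDelta_mul_self hd aᵢ) v n₂ hT₁ hT₂ hT₁d hT₂d hJ₁ hJV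
        (lineTransportSection F E c (1 + n₂) hcδ hδ hd (UnitaryGroup.finSum 1 n₂ T₁ T₂) (UnitaryGroup.isSymm_finSum hT₁ hT₂) JV hJV aⱼ v sⱼ' hsⱼ')
        (proj_lineTransportSection F E c (1 + n₂) hcδ hδ hd (UnitaryGroup.finSum 1 n₂ T₁ T₂) (UnitaryGroup.isSymm_finSum hT₁ hT₂) JV hJV aⱼ v sⱼ' hsⱼ')
        (lineTransportSection F E c (1 + n₂) hcδ hδ hd (UnitaryGroup.finSum 1 n₂ T₁ T₂) (UnitaryGroup.isSymm_finSum hT₁ hT₂) JV hJV aᵢ v sᵢ' hsᵢ')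
        (proj_lineTransportSection F E c (1 + n₂) hcδ hδ hd (UnitaryGroup.finSum 1 n₂ T₁ T₂) (UnitaryGroup.isSymm_finSum hT₁ hT₂) JV hJV aᵢ v sᵢ' hsᵢ')
        hE
        (isSmooth_lineTransportSection F E c (1 + n₂) hcδ hδ hd (UnitaryGroup.finSum 1 n₂ T₁ T₂) (UnitaryGroup.isSymm_finSum hT₁ hT₂) JV hJV aⱼ v sⱼ' hsⱼ' hsmⱼ)
        (isSmooth_lineTransportSection F E c (1 + n₂) hcδ hδ hd (UnitaryGroup.finSum 1 n₂ T₁ T₂) (UnitaryGroup.isSymm_finSum hT₁ hT₂) JV hJV aᵢ v sᵢ' hsᵢ' hsmᵢ)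
        hdich)
      hnt hiso

/-! ## §4 (edition 3) The complementarity door with the frame as a VARIABLE (`subst`-transport, as §2) -/

section ComplementOfEq

variable {TV' : Matrix (Fin (1 + n₂)) (Fin (1 + n₂)) F} (hT : UnitaryGroup.finSum 1 n₂ T₁ T₂ = TV') (hV' : TV'.IsSymm)
  (hJV' : JV = TV'.map (algebraMap F E)) (hJVf : JV = (UnitaryGroup.finSum 1 n₂ T₁ T₂).map (algebraMap F E))
  (sⱼ'' : localPi E c (1 + n₂) (Matrix.reindex (Equiv.prodUnique (Fin (1 + n₂)) (Fin 1)) (Equiv.prodUnique (Fin (1 + n₂)) (Fin 1)) (JV ⊗ₖ JW F E aⱼ)) v →*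
      LocalMp F (1 + n₂) (gram F (Equiv.prodUnique (Fin (1 + n₂)) (Fin 1)) TV' (TW F aⱼ)) v)
  (hsⱼ'' : ∀ g, MpPsi.proj _ (sⱼ'' g) = iota F E c (1 + n₂) hcδ hδ hd (gram F (Equiv.prodUnique (Fin (1 + n₂)) (Fin 1)) TV' (TW F aⱼ))
      (isSymm_gram F (Equiv.prodUnique (Fin (1 + n₂)) (Fin 1)) hV' (isSymm_TW F aⱼ))
      (reindex_kronecker_eq_gram_map F E (Equiv.prodUnique (Fin (1 + n₂)) (Fin 1)) hJV' (JW_eq F E aⱼ)) v g)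
  (sᵢ'' : localPi E c (1 + n₂) (Matrix.reindex (Equiv.prodUnique (Fin (1 + n₂)) (Fin 1)) (Equiv.prodUnique (Fin (1 + n₂)) (Fin 1)) (JV ⊗ₖ JW F E aᵢ)) v →*
      LocalMp F (1 + n₂) (gram F (Equiv.prodUnique (Fin (1 + n₂)) (Fin 1)) TV' (TW F aᵢ)) v)
  (hsᵢ'' : ∀ g, MpPsi.proj _ (sᵢ'' g) = iota F E c (1 + n₂) hcδ hδ hd (gram F (Equiv.prodUnique (Fin (1 + n₂)) (Fin 1)) TV' (TW F aᵢ))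
      (isSymm_gram F (Equiv.prodUnique (Fin (1 + n₂)) (Fin 1)) hV' (isSymm_TW F aᵢ))
      (reindex_kronecker_eq_gram_map F E (Equiv.prodUnique (Fin (1 + n₂)) (Fin 1)) hJV' (JW_eq F E aᵢ)) v g)
  (rⱼ' : localPi E c (1 + n₂) (Matrix.reindex (Equiv.prodUnique (Fin (1 + n₂)) (Fin 1)) (Equiv.prodUnique (Fin (1 + n₂)) (Fin 1)) (JV ⊗ₖ JW F E aⱼ)) v →*
      LocalMp F (1 + n₂) (gram F (Equiv.prodUnique (Fin (1 + n₂)) (Fin 1)) (UnitaryGroup.finSum 1 n₂ T₁ T₂) (TW F aⱼ)) v)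
  (hrⱼ' : ∀ g, MpPsi.proj _ (rⱼ' g) = iota F E c (1 + n₂) hcδ hδ hd (gram F (Equiv.prodUnique (Fin (1 + n₂)) (Fin 1)) (UnitaryGroup.finSum 1 n₂ T₁ T₂) (TW F aⱼ))
      (isSymm_gram F (Equiv.prodUnique (Fin (1 + n₂)) (Fin 1)) (UnitaryGroup.isSymm_finSum hT₁ hT₂) (isSymm_TW F aⱼ))
      (reindex_kronecker_eq_gram_map F E (Equiv.prodUnique (Fin (1 + n₂)) (Fin 1)) hJVf (JW_eq F E aⱼ)) v g)
  (rᵢ' : localPi E c (1 + n₂) (Matrix.reindex (Equiv.prodUnique (Fin (1 + n₂)) (Fin 1)) (Equiv.prodUnique (Fin (1 + n₂)) (Fin 1)) (JV ⊗ₖ JW F E aᵢ)) v →*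
      LocalMp F (1 + n₂) (gram F (Equiv.prodUnique (Fin (1 + n₂)) (Fin 1)) (UnitaryGroup.finSum 1 n₂ T₁ T₂) (TW F aᵢ)) v)
  (hrᵢ' : ∀ g, MpPsi.proj _ (rᵢ' g) = iota F E c (1 + n₂) hcδ hδ hd (gram F (Equiv.prodUnique (Fin (1 + n₂)) (Fin 1)) (UnitaryGroup.finSum 1 n₂ T₁ T₂) (TW F aᵢ))
      (isSymm_gram F (Equiv.prodUnique (Fin (1 + n₂)) (Fin 1)) (UnitaryGroup.isSymm_finSum hT₁ hT₂) (isSymm_TW F aᵢ))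
      (reindex_kronecker_eq_gram_map F E (Equiv.prodUnique (Fin (1 + n₂)) (Fin 1)) hJVf (JW_eq F E aᵢ)) v g)

-- the composite after two `subst`s: about 3× the default budget
set_option maxHeartbeats 800000 in
include hT₁d hJ₂ hT hrⱼ' hrᵢ' in
/-- **SEPARATION AT `v` FROM BLOCK-0 COMPLEMENTARITY, FRAME AS A VARIABLE** (edition 3): `hsep_of_blockZero_complement` for a consumer whose frame `T_V` is
typed by a Gram term PROPOSITIONALLY equal to `T₁ ⊕ T₂` (`hT : UnitaryGroup.finSum 1 n₂ T₁ T₂ = T_V`), its pair-model sections `s″_t` (typed over `T_V`) linked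
to block-frame copies `r′_t` by `HEq`; the hypothesis `hdich` is stated on the copies, the conclusion is the `hsep` over `T_V`.  Proof: `subst hT`, `eq_of_heq`,
§3. [cite: HarrisKudlaSweet1996, Cor. 4.4 p. 962, Thm. 6.1] [cite: SunZhu2014, Thm. 1.10] [cite: MoeglinVignerasWaldspurger1987, Chap. 3 §IV.4]
[cite: Liu2021, App. D Lemma D.1 (4) (p. 126, l. 5235)] -/
theorem hsep_of_blockZero_complement_of_eq (hE : IsField (LocalRing E v))
    (hheqⱼ : HEq rⱼ' sⱼ'') (hheqᵢ : HEq rᵢ' sᵢ'')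
    (hsmⱼ : Representation.IsSmooth
      ((MpPsi.toRep (localSchrodinger F (1 + n₂) (gram F (Equiv.prodUnique (Fin (1 + n₂)) (Fin 1)) TV' (TW F aⱼ)) v)).comp sⱼ''))
    (hsmᵢ : Representation.IsSmooth
      ((MpPsi.toRep (localSchrodinger F (1 + n₂) (gram F (Equiv.prodUnique (Fin (1 + n₂)) (Fin 1)) TV' (TW F aᵢ)) v)).comp sᵢ''))
    (hdich : ∀ ξ : localPi E c 1 J₁ v →* ℂˣ, IsOpen (ξ.ker : Set (localPi E c 1 J₁ v)) →
      Module.finrank ℂ (weightSpace ((MpPsi.toRep (localSchrodinger F 1 T₁ v)).comp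
                (restrictLeft F E c v 1 n₂ hJ₁ hJVf (conj_lineDelta hcδ aⱼ) (lineDelta_ne_zero hδ aⱼ) (lineDelta_mul_self hd aⱼ) hT₁ hT₂ hT₂d (lineTransportSection F E c (1 + n₂) hcδ hδ hd (UnitaryGroup.finSum 1 n₂ T₁ T₂) (UnitaryGroup.isSymm_finSum hT₁ hT₂) JV hJVf aⱼ v rⱼ' hrⱼ') (proj_lineTransportSection F E c (1 + n₂) hcδ hδ hd (UnitaryGroup.finSum 1 n₂ T₁ T₂) (UnitaryGroup.isSymm_finSum hT₁ hT₂) JV hJVf aⱼ v rⱼ' hrⱼ'))) id (fun k => ((ξ k : ℂˣ) : ℂ))) +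
        Module.finrank ℂ (weightSpace ((MpPsi.toRep (localSchrodinger F 1 T₁ v)).comp
                (restrictLeft F E c v 1 n₂ hJ₁ hJVf (conj_lineDelta hcδ aᵢ) (lineDelta_ne_zero hδ aᵢ) (lineDelta_mul_self hd aᵢ) hT₁ hT₂ hT₂d (lineTransportSection F E c (1 + n₂) hcδ hδ hd (UnitaryGroup.finSum 1 n₂ T₁ T₂) (UnitaryGroup.isSymm_finSum hT₁ hT₂) JV hJVf aᵢ v rᵢ' hrᵢ') (proj_lineTransportSection F E c (1 + n₂) hcδ hδ hd (UnitaryGroup.finSum 1 n₂ T₁ T₂) (UnitaryGroup.isSymm_finSum hT₁ hT₂) JV hJVf aᵢ v rᵢ' hrᵢ'))) id (fun k => ((ξ k : ℂˣ) : ℂ))) = 1)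
    (χⱼ χᵢ : localPi E c 1 (JW F E aⱼ) v →* ℂˣ) :
    (¬ ∃ x : (LocalRing E v)ˣ, LemD1OfPlace.eps E v (lineDelta_ne_zero hδ aᵢ) =
        x * Units.map (conjLocal E c v : LocalRing E v →* LocalRing E v) x * LemD1OfPlace.eps E v (lineDelta_ne_zero hδ aⱼ)) →
      Nontrivial (TwistedCoinv.Coinv
        ((show Representation ℂ (localPi E c 1 (JW F E aⱼ) v) (SchwartzBruhat (Fin (1 + n₂) → v.adicCompletion F)) from
          ((MpPsi.toRep (localSchrodinger F (1 + n₂) TV' v)).comp (lineTransportSection F E c (1 + n₂) hcδ hδ hd TV' hV' JV hJV' aⱼ v sⱼ'' hsⱼ'')).comp (localCenter E c (1 + n₂) JV (JW F E aⱼ) (JW_apply_ne_zero F E aⱼ) v))) χⱼ) →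
      AreIsomorphicRep
        (TwistedCoinv.rep
          (ρW := show Representation ℂ (localPi E c 1 (JW F E aⱼ) v) (SchwartzBruhat (Fin (1 + n₂) → v.adicCompletion F)) from
            ((MpPsi.toRep (localSchrodinger F (1 + n₂) TV' v)).comp (lineTransportSection F E c (1 + n₂) hcδ hδ hd TV' hV' JV hJV' aⱼ v sⱼ'' hsⱼ'')).comp (localCenter E c (1 + n₂) JV (JW F E aⱼ) (JW_apply_ne_zero F E aⱼ) v))
          χⱼ ((MpPsi.toRep (localSchrodinger F (1 + n₂) TV' v)).comp (lineTransportSection F E c (1 + n₂) hcδ hδ hd TV' hV' JV hJV' aⱼ v sⱼ'' hsⱼ''))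
          (fun g z => (show Commute g ((localCenter E c (1 + n₂) JV (JW F E aⱼ) (JW_apply_ne_zero F E aⱼ) v) z) from
            localCenter_comm E c (1 + n₂) JV (JW F E aⱼ) (JW_apply_ne_zero F E aⱼ) v z g).map ((MpPsi.toRep (localSchrodinger F (1 + n₂) TV' v)).comp (lineTransportSection F E c (1 + n₂) hcδ hδ hd TV' hV' JV hJV' aⱼ v sⱼ'' hsⱼ''))))
        (TwistedCoinv.rep
          (ρW := show Representation ℂ (localPi E c 1 (JW F E aⱼ) v) (SchwartzBruhat (Fin (1 + n₂) → v.adicCompletion F)) from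
            ((MpPsi.toRep (localSchrodinger F (1 + n₂) TV' v)).comp (lineTransportSection F E c (1 + n₂) hcδ hδ hd TV' hV' JV hJV' aᵢ v sᵢ'' hsᵢ'')).comp (localCenter E c (1 + n₂) JV (JW F E aⱼ) (JW_apply_ne_zero F E aⱼ) v))
          χᵢ ((MpPsi.toRep (localSchrodinger F (1 + n₂) TV' v)).comp (lineTransportSection F E c (1 + n₂) hcδ hδ hd TV' hV' JV hJV' aᵢ v sᵢ'' hsᵢ''))
          (fun g z => (show Commute g ((localCenter E c (1 + n₂) JV (JW F E aⱼ) (JW_apply_ne_zero F E aⱼ) v) z) from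
            localCenter_comm E c (1 + n₂) JV (JW F E aⱼ) (JW_apply_ne_zero F E aⱼ) v z g).map ((MpPsi.toRep (localSchrodinger F (1 + n₂) TV' v)).comp (lineTransportSection F E c (1 + n₂) hcδ hδ hd TV' hV' JV hJV' aᵢ v sᵢ'' hsᵢ'')))) →
      False := by
  subst hT
  obtain rfl := eq_of_heq hheqⱼ
  obtain rfl := eq_of_heq hheqᵢ
  exact hsep_of_blockZero_complement F E c hcδ hδ hd hT₁ hT₂ hT₁d hT₂d hJ₁ hJ₂ JV hJVf aⱼ aᵢ v rⱼ' hrⱼ' rᵢ' hrᵢ' hE hsmⱼ hsmᵢ hdich χⱼ χᵢ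

end ComplementOfEq

end Literature.NumberTheory.Automorphic.Liu2021.Def411WeilCarriers

end
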